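import Summits.FinalStateConjecture.FinalStateConjecture.Theorems.EIHFluxBalanceInertialRecessionStubIdentificationCompare
import Summits.FinalStateConjecture.FinalStateConjecture.Theorems.EIHFluxBalanceInertialRecessionStubIdentificationLipschitz

/-!
# Route EIHFluxBalance — `InertialRecession`, line `sublinear-is-free-clean-window-charges`:
# the small-sphere comparison of the identification (stub `stub_identification`, part A5b, main)

Helper file (`--supports stmt-FinalStateConjecture-10166`) for the crux
`Summit.FinalStateConjecture.FinalStateConjecture.Theses.EIHFluxBalance.InertialRecession`.

`abs_quasiLocalMomentum_lab_sub_frozen_le`: on the sphere `S_j = {|y − ξ_j(t)| = ρ₀}` about hole `j`,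
the charges of the lab field `g = η + Σ_i (painted_i − η) + dev` and of the frozen field
`G_j = boostedKerrBilin (Λ j t) (t, ξ j t) (M j) (a j)` differ by at most
`C ρ₀² ( Σ_i (G³ C_i / D_h² + Δ_i) + ε₁ + (Σ_i G² |M_i| B₀ / D_h + ε₀) G³ C_j / ρ₀² )`,
where `D_h ≥ ρ₀` bounds from below the distance of `S_j` to the other centres, `Δ_i` bounds the
modulation defects `‖D painted_i − D frozen_i‖` on `S_j`, and `ε₀, ε₁` bound the deviation and its
derivative there (the Lipschitz estimate `exists_abs_quasiLocalMomentum_sub_le` fed with the pointwise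
bounds of `…Compare`). All constants are universal or depend only on `(M_i, a_i)`; nothing depends on
the rotation of the frames. [cite: LandauLifshitz1975, §96 (96.16)]
-/

set_option linter.dupNamespace false
-- instance search on the nested operator spaces `E4 →L[ℝ] E4 →L[ℝ] ℝ` is deep
set_option maxSynthPendingDepth 3

noncomputable section

namespace Summit.FinalStateConjecture.FinalStateConjecture.Theorems.SublinearIsFree.ChargeModel

open scoped BigOperators Topology ContDiff
open Filter Set Metric Function Literature.Geometry.Lorentzian Literature.Geometry.Lorentzian.LandauLifshitz
open Summit.FinalStateConjecture.FinalStateConjecture.Theorems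
open Summit.FinalStateConjecture.FinalStateConjecture.Theorems.InertialRecession.Negative
open SublinearIsFree.QuasiStationarity

/-- Norm of a finite sum of differences against a Kronecker-selected term:
`‖Σ_i u_i − w‖ ≤ Σ_i ‖u_i − [i = j] w‖`. [folklore] -/
theorem norm_sum_sub_le_sum_norm_sub_ite {V : Type*} [SeminormedAddCommGroup V] {N : ℕ} (u : Fin N → V)
    (w : V) (j : Fin N) :
    ‖(∑ i, u i) - w‖ ≤ ∑ i, ‖u i - if i = j then w else 0‖ := by
  have h : (∑ i, u i) - w = ∑ i, (u i - if i = j then w else 0) := by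
    rw [Finset.sum_sub_distrib, Finset.sum_ite_eq' Finset.univ j (fun _ ↦ w)]
    simp
  rw [h]
  exact norm_sum_le _ _

-- operator-norm instance paths on form-valued maps are slow to unify
set_option synthInstance.maxHeartbeats 200000 in
/-- **The small-sphere comparison.** See the module docstring. Hypotheses, all on the sphere
`{|y − ξ_j(t)| = ρ₀}`: `C¹` motions with `|(Λ_i(t)e₀)⁰| ≤ γ` and `C¹` centres; `ρ₀` beyond the decay
thresholds of every hole and `ρ₀ ≤ D_h ≤` the distance to the other centres; the deviation `dev`
differentiable with `‖dev‖ ≤ ε₀`, `‖D dev‖ ≤ ε₁`; defect bounds `Δ_i`; both fields within `1/2` of `η`;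
continuous momentum densities. [cite: LandauLifshitz1975, §96 (96.16)] -/
theorem abs_quasiLocalMomentum_lab_sub_frozen_le {N : ℕ} (M a : Fin N → ℝ) :
    ∃ (C B₀ : ℝ) (Cf Rf : Fin N → ℝ), 0 ≤ C ∧ 0 ≤ B₀ ∧ (∀ i, 0 ≤ Cf i ∧ 0 < Rf i) ∧
      ∀ (Λ : Fin N → ℝ → lorentzGroup) (ξ : Fin N → ℝ → E3) (γ : ℝ)
        (dev : E4 → E4 →L[ℝ] E4 →L[ℝ] ℝ) (t : ℝ) (j : Fin N) (ρ₀ Dh ε₀ ε₁ : ℝ) (Δ : Fin N → ℝ)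
        (μ : Fin 4),
      (∀ i, ContDiff ℝ 1 (fun s ↦ ((Λ i s : E4 ≃L[ℝ] E4) : E4 →L[ℝ] E4))) → (∀ i, ContDiff ℝ 1 (ξ i)) →
      (∀ i, |((Λ i t : E4 ≃L[ℝ] E4) (E4.basisVector 0)) 0| ≤ γ) →
      0 < ρ₀ → (∀ i, Rf i + |a i| ≤ ρ₀) → (∀ i, max 1 (2 * |a i|) ≤ ρ₀) → ρ₀ ≤ Dh →
      0 ≤ ε₀ → 0 ≤ ε₁ → (∀ i, 0 ≤ Δ i) →
      (∀ i, i ≠ j → ∀ y ∈ sphere (ξ j t) ρ₀, Dh ≤ ‖y - ξ i t‖) →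
      (∀ y ∈ sphere (ξ j t) ρ₀, DifferentiableAt ℝ dev (E4.ofTimeSpace t y) ∧
        ‖dev (E4.ofTimeSpace t y)‖ ≤ ε₀ ∧ ‖fderiv ℝ dev (E4.ofTimeSpace t y)‖ ≤ ε₁) →
      (∀ i, ∀ y ∈ sphere (ξ j t) ρ₀,
        ‖fderiv ℝ (fun x : E4 ↦ boostedKerrBilin (Λ i (x 0)) (E4.ofTimeSpace (x 0) (ξ i (x 0))) (M i) (a i) x)
            (E4.ofTimeSpace t y) -
          fderiv ℝ (boostedKerrBilin (Λ i t) (E4.ofTimeSpace t (ξ i t)) (M i) (a i)) (E4.ofTimeSpace t y)‖ ≤ Δ i) →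
      (∀ y ∈ sphere (ξ j t) ρ₀,
        ‖(fun x : E4 ↦ (Minkowski.bilin + ∑ i, (boostedKerrBilin (Λ i (x 0)) (E4.ofTimeSpace (x 0) (ξ i (x 0)))
            (M i) (a i) x - Minkowski.bilin)) + dev x) (E4.ofTimeSpace t y) - Minkowski.bilin‖ ≤ 1 / 2 ∧
        ‖boostedKerrBilin (Λ j t) (E4.ofTimeSpace t (ξ j t)) (M j) (a j) (E4.ofTimeSpace t y) - Minkowski.bilin‖ ≤ 1 / 2) →
      (∀ k : Fin 3, ContinuousOn (fun y ↦ hField (fun x : E4 ↦ (Minkowski.bilin + ∑ i,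
          (boostedKerrBilin (Λ i (x 0)) (E4.ofTimeSpace (x 0) (ξ i (x 0))) (M i) (a i) x - Minkowski.bilin)) + dev x)
          (E4.ofTimeSpace t y) μ 0 k.succ) (sphere (ξ j t) ρ₀)) →
      (∀ k : Fin 3, ContinuousOn (fun y ↦ hField (boostedKerrBilin (Λ j t) (E4.ofTimeSpace t (ξ j t)) (M j) (a j))
          (E4.ofTimeSpace t y) μ 0 k.succ) (sphere (ξ j t) ρ₀)) →
      |quasiLocalMomentum (fun x : E4 ↦ (Minkowski.bilin + ∑ i, (boostedKerrBilin (Λ i (x 0))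
            (E4.ofTimeSpace (x 0) (ξ i (x 0))) (M i) (a i) x - Minkowski.bilin)) + dev x) t (ξ j t) ρ₀ μ -
        quasiLocalMomentum (boostedKerrBilin (Λ j t) (E4.ofTimeSpace t (ξ j t)) (M j) (a j)) t (ξ j t) ρ₀ μ| ≤
        C * ρ₀ ^ 2 * ((∑ i, ((1 + 3 * γ) ^ 3 * Cf i / Dh ^ 2 + Δ i)) + ε₁ +
          ((∑ i, (1 + 3 * γ) ^ 2 * (|M i| * B₀ / Dh)) + ε₀) * ((1 + 3 * γ) ^ 3 * Cf j / ρ₀ ^ 2)) := by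
  obtain ⟨C, hC, hLip⟩ := exists_abs_quasiLocalMomentum_sub_le
  obtain ⟨B₀, hB₀, hval⟩ := norm_frozen_sub_minkowski_le
  have hfro := fun i ↦ norm_fderiv_frozen_le (M i) (a i)
  choose Cf Rf hCf hRf hfro using hfro
  refine ⟨C, B₀, Cf, Rf, hC, hB₀, fun i ↦ ⟨hCf i, hRf i⟩, ?_⟩
  intro Λ ξ γ dev t j ρ₀ Dh ε₀ ε₁ Δ μ hΛ hξ hγ hρ₀ hRf hmax hDh hε₀ hε₁ hΔ hfar hdev hdef hη hcg hcG
  -- names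
  set P : Fin N → E4 → E4 →L[ℝ] E4 →L[ℝ] ℝ := fun i x ↦
    boostedKerrBilin (Λ i (x 0)) (E4.ofTimeSpace (x 0) (ξ i (x 0))) (M i) (a i) x with hP
  set F : Fin N → E4 → E4 →L[ℝ] E4 →L[ℝ] ℝ := fun i ↦
    boostedKerrBilin (Λ i t) (E4.ofTimeSpace t (ξ i t)) (M i) (a i) with hF
  set g : E4 → E4 →L[ℝ] E4 →L[ℝ] ℝ := fun x ↦ (Minkowski.bilin + ∑ i, (P i x - Minkowski.bilin)) + dev x with hg
  set G : ℝ := 1 + 3 * γ with hG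
  have hγ1 : 1 ≤ γ := (one_le_abs_lorentz_apply_zero (Λ j t)).trans (hγ j)
  have hG0 : 0 ≤ G := by rw [hG]; linarith
  have hAG : ∀ i, ‖(((Λ i t : E4 ≃L[ℝ] E4).symm : E4 →L[ℝ] E4))‖ ≤ G := fun i ↦
    (norm_lorentz_symm_le' (Λ i t)).trans (by rw [hG]; linarith [hγ i])
  have hDh0 : 0 < Dh := hρ₀.trans_le hDh
  -- the pointwise package on the sphere
  set δ₁ : ℝ := (∑ i, (G ^ 3 * Cf i / Dh ^ 2 + Δ i)) + ε₁ with hδ₁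
  set δ₀ : ℝ := (∑ i, G ^ 2 * (|M i| * B₀ / Dh)) + ε₀ with hδ₀
  set b : ℝ := G ^ 3 * Cf j / ρ₀ ^ 2 with hb
  have hδ₀0 : 0 ≤ δ₀ := add_nonneg (Finset.sum_nonneg fun i _ ↦
    mul_nonneg (pow_nonneg hG0 2) (div_nonneg (mul_nonneg (abs_nonneg _) hB₀) hDh0.le)) hε₀
  have hb0 : 0 ≤ b := div_nonneg (mul_nonneg (pow_nonneg hG0 3) (hCf j)) (sq_nonneg _)
  have hpt : ∀ y ∈ sphere (ξ j t) ρ₀, DifferentiableAt ℝ g (E4.ofTimeSpace t y) ∧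
      DifferentiableAt ℝ (F j) (E4.ofTimeSpace t y) ∧
      ‖g (E4.ofTimeSpace t y) - Minkowski.bilin‖ ≤ 1 / 2 ∧
      ‖F j (E4.ofTimeSpace t y) - Minkowski.bilin‖ ≤ 1 / 2 ∧
      ‖fderiv ℝ g (E4.ofTimeSpace t y) - fderiv ℝ (F j) (E4.ofTimeSpace t y)‖ ≤ δ₁ ∧
      ‖g (E4.ofTimeSpace t y) - F j (E4.ofTimeSpace t y)‖ ≤ δ₀ ∧
      ‖fderiv ℝ (F j) (E4.ofTimeSpace t y)‖ ≤ b := by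
    intro y hy
    set x : E4 := E4.ofTimeSpace t y with hx
    have hx0 : x 0 = t := rfl
    have hxs : E4.spatial x = y := E4.spatial_ofTimeSpace t y
    have hdj : ‖E4.spatial x - ξ j t‖ = ρ₀ := by
      have hy' := hy
      rw [mem_sphere, dist_eq_norm] at hy'
      rw [hxs]
      exact hy'
    have hdi : ∀ i, ρ₀ ≤ ‖E4.spatial x - ξ i t‖ := fun i ↦ by
      by_cases hij : i = j
      · rw [hij, hdj]
      · rw [hxs]; exact hDh.trans (hfar i hij y hy)
    have hdi' : ∀ i, i ≠ j → Dh ≤ ‖E4.spatial x - ξ i t‖ := fun i hij ↦ by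
      rw [hxs]; exact hfar i hij y hy
    -- differentiability and bounds of the summands
    have hPd : ∀ i, DifferentiableAt ℝ (P i) x := fun i ↦ by
      have h1 := (contDiffAt_summand (M := M i) (a := a i) (hΛ i) (hξ i) hx0
        ((hmax i).trans (hdi i))).differentiableAt one_ne_zero
      have h2 := h1.add_const Minkowski.bilin
      simpa only [sub_add_cancel] using h2
    have hFdb : ∀ i, DifferentiableAt ℝ (F i) x ∧ ‖fderiv ℝ (F i) x‖ ≤ G ^ 3 * Cf i / ‖E4.spatial x - ξ i t‖ ^ 2 :=
      fun i ↦ by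
        obtain ⟨hd, hbd⟩ := hfro i (Λ i t) (ξ i t) t x hx0 ((hRf i).trans (hdi i))
        refine ⟨hd, hbd.trans ?_⟩
        have h3 : ‖(((Λ i t : E4 ≃L[ℝ] E4).symm : E4 →L[ℝ] E4))‖ ^ 3 ≤ G ^ 3 :=
          pow_le_pow_left₀ (norm_nonneg _) (hAG i) 3
        exact div_le_div_of_nonneg_right (mul_le_mul_of_nonneg_right h3 (hCf i)) (sq_nonneg _)
    obtain ⟨hdevd, hdev0, hdev1⟩ := hdev y hy
    -- `g` and its derivative
    have hsumd : DifferentiableAt ℝ (fun x ↦ ∑ i, (P i x - Minkowski.bilin)) x :=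
      DifferentiableAt.fun_sum fun i _ ↦ (hPd i).sub_const _
    have hgd : DifferentiableAt ℝ g x := (hsumd.const_add _).add hdevd
    have hDg : fderiv ℝ g x = (∑ i, fderiv ℝ (P i) x) + fderiv ℝ dev x := by
      rw [hg, fderiv_fun_add (hsumd.const_add _) hdevd, fderiv_const_add,
        fderiv_fun_sum fun i _ ↦ (hPd i).sub_const _]
      congr 1
      exact Finset.sum_congr rfl fun i _ ↦ fderiv_sub_const _
    refine ⟨hgd, (hFdb j).1, (hη y hy).1, (hη y hy).2, ?_, ?_, ?_⟩
    · -- derivatives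
      rw [hDg, add_sub_right_comm]
      refine (norm_add_le _ _).trans (add_le_add ?_ hdev1)
      refine (norm_sum_sub_le_sum_norm_sub_ite (fun i ↦ fderiv ℝ (P i) x) (fderiv ℝ (F j) x) j).trans
        (Finset.sum_le_sum fun i _ ↦ ?_)
      by_cases hij : i = j
      · subst hij
        rw [if_pos rfl]
        have h := hdef i y hy
        refine h.trans ?_
        have : 0 ≤ G ^ 3 * Cf i / Dh ^ 2 := div_nonneg (mul_nonneg (pow_nonneg hG0 3) (hCf i)) (sq_nonneg _)
        linarith
      · rw [if_neg hij, sub_zero]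
        have h1 : ‖fderiv ℝ (P i) x‖ ≤ ‖fderiv ℝ (F i) x‖ + Δ i := by
          have h := hdef i y hy
          have := norm_sub_norm_le (fderiv ℝ (P i) x) (fderiv ℝ (F i) x)
          linarith
        refine h1.trans (add_le_add ((hFdb i).2.trans ?_) le_rfl)
        exact div_le_div_of_nonneg_left (mul_nonneg (pow_nonneg hG0 3) (hCf i)) (pow_pos hDh0 2)
          (pow_le_pow_left₀ hDh0.le (hdi' i hij) 2)
    · -- values
      have hval_eq : g x - F j x = (∑ i, (P i x - Minkowski.bilin - if i = j then F j x - Minkowski.bilin else 0)) +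
          dev x := by
        rw [Finset.sum_sub_distrib, Finset.sum_ite_eq' Finset.univ j (fun _ ↦ F j x - Minkowski.bilin)]
        simp only [Finset.mem_univ, if_true, hg]
        abel
      rw [hval_eq]
      refine (norm_add_le _ _).trans (add_le_add ((norm_sum_le _ _).trans (Finset.sum_le_sum fun i _ ↦ ?_)) hdev0)
      by_cases hij : i = j
      · subst hij
        rw [if_pos rfl, show P i x = F i x from painted_eq_frozen_of_apply_zero (Λ i) (ξ i) (M i) (a i) hx0,
          sub_self, norm_zero]
        exact mul_nonneg (pow_nonneg hG0 2) (div_nonneg (mul_nonneg (abs_nonneg _) hB₀) hDh0.le)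
      · rw [if_neg hij, sub_zero]
        have h := hval (Λ i t) (ξ i t) (M i) (a i) t x hx0 ((hmax i).trans (hdi i))
        rw [show P i x = F i x from painted_eq_frozen_of_apply_zero (Λ i) (ξ i) (M i) (a i) hx0]
        refine h.trans ?_
        have h2 : ‖(((Λ i t : E4 ≃L[ℝ] E4).symm : E4 →L[ℝ] E4))‖ ^ 2 ≤ G ^ 2 :=
          pow_le_pow_left₀ (norm_nonneg _) (hAG i) 2
        have h3 : |M i| * B₀ / ‖E4.spatial x - ξ i t‖ ≤ |M i| * B₀ / Dh :=
          div_le_div_of_nonneg_left (by positivity) hDh0 (hdi' i hij)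
        exact mul_le_mul h2 h3 (by positivity) (pow_nonneg hG0 2)
    · -- `b`
      refine (hFdb j).2.trans (le_of_eq ?_)
      rw [hdj]
  have h := hLip g (F j) t (ξ j t) ρ₀ δ₁ δ₀ b hρ₀ hδ₀0 hb0 hpt μ hcg hcG
  exact h

/-- Registered sub-goal form (stub `ll_norm_sum_sub_le_sum_norm_sub_ite` of the crux item) of
`norm_sum_sub_le_sum_norm_sub_ite`, the bookkeeping inequality of the small-sphere comparison
`abs_quasiLocalMomentum_lab_sub_frozen_le`. [folklore] -/
theorem _root_.Summit.FinalStateConjecture.FinalStateConjecture.Theorems.ll_norm_sum_sub_le_sum_norm_sub_ite : ∀ {V : Type*} [SeminormedAddCommGroup V] {N : ℕ} (u : Fin N → V) (w : V) (j : Fin N), ‖(∑ i, u i) - w‖ ≤ ∑ i, ‖u i - if i = j then w else 0‖ :=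
  fun u w j ↦ norm_sum_sub_le_sum_norm_sub_ite u w j

end Summit.FinalStateConjecture.FinalStateConjecture.Theorems.SublinearIsFree.ChargeModel

end
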